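import Summits.Ventures.LatticeQCDFlow.Exactness.IMHWeightLevelMasses
import HarnessLib

/-!
# Weight tails put a floor under EVERY autocorrelation of the flow sampler: `ρ(n) ≥ (1 − 1/t)ⁿ π_g(b > tZ)`

HONEST FRAMING: exact (Metropolis-corrected) sampling algorithms for lattice gauge theory;
figures of merit are autocorrelation/cost numbers at stated couplings and volumes; no
continuum-physics claim.  (SCALAR calibration rung S0-A: not a gauge result.)

Venture `LatticeQCDFlow` (cell pub-lqcd), topic `Exactness`; FANOUT row 2 (`s0-phi4`, FLOW arm).
NEW WORK of the cell: the all-lag sticking floor of `IMHStickingFloorAllLags.lean`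
(`C(n+1) ≥ ∫ g² w r^{n+1}`, from the cell's Smith–Tierney theorem) combined with the elementary
bound `r = λ(b) ≥ 1 − Z/b` on the rejection probability (`1 − λ(v) = M(v)/v ≤ Z/v`,
`IMHWeightLevelMasses`).  Nothing is cited as a fact; Mengersen–Tweedie 1996 (no geometric
ergodicity for unbounded weights) NAMED ONLY — the statement here is observable by observable and
quantitative at every lag.

## What is proved (`w, q > 0` measurable integrable, `∫ q = 1`, `Z = ∫ w`, `b = w/q`,
`K = imhOp μ w q`, `C(n) = ∫ g (Kⁿ g) w`, `g` bounded measurable; `t > 0`)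

* `rejCurve_ge_one_sub_div` — `λ(v) ≥ 1 − Z/v` (`v > 0`);
* **`autocov_ge_weightTail`** — `C(n+1) ≥ (1 − 1/t)^{n+1} ∫ 1[b > tZ] g² w dμ` for every `t ≥ 1`:
  the `g²`-mass sitting where the importance weight exceeds `t` mean weights keeps a fraction
  `(1 − 1/t)^{n+1}` of its autocovariance after `n+1` steps;
* **`autocorr_ge_weightTail`** — normalised: `ρ(n+1) ≥ (1 − 1/t)^{n+1} E_{g²w}[1[b > tZ]]/E[g²w]`;
* the lattice (row 2's `imhOpPhi4 J λ q̃`, `g = f − ⟨f⟩`): **`phi4Flow_autocov_ge_weightTail`**.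

Reading for S0-A (no numerics implied): a finite second weight moment makes `τ_int` finite
(`IMHTauIntFiniteOfWeightMoment`), but the DECAY of the autocorrelations is only as fast as the
weight tail allows — with `t = n` the floor reads `ρ(n) ≳ e^{−1} π_{g²}(b > nZ)`, so a polynomial
tail `π(b > tZ) ∼ t^{−α}` forces polynomial, not geometric, decorrelation of every observable
charged on the tail; geometric decay for all bounded observables requires bounded weights.
NOT CLAIMED: upper bounds on `ρ(n)`; HMC / local Metropolis; any number for a trained network.
-/

namespace Summit.Ventures.LatticeQCDFlow.Exactness

open Real MeasureTheory Filter Set Topology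
open Summit.Ventures.LatticeQCDFlow.Scoring

variable {X : Type*} [MeasurableSpace X] {μ : Measure X} {w q : X → ℝ}

variable [SFinite μ]

omit [SFinite μ] in
/-- **`λ(v) ≥ 1 − Z/v`** for `v > 0`: a state of weight `v` rejects at least the fraction `1 − Z/v`
of its proposals (`1 − λ(v) = M(v)/v ≤ Z/v`). -/
theorem rejCurve_ge_one_sub_div (hw0 : ∀ t, 0 < w t) (hwm : Measurable w) (hwi : Integrable w μ)
    (hq0 : ∀ t, 0 < q t) (hqm : Measurable q) (hqi : Integrable q μ) (hq1 : ∫ z, q z ∂μ = 1)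
    {v : ℝ} (hv : 0 < v) :
    1 - (∫ z, w z ∂μ) / v ≤ rejCurve μ w q v := by
  have hM := mul_one_sub_rejCurve hw0 hwm hq0 hqm hqi hq1 hv
  have hMZ : ∫ z, min (w z) (v * q z) ∂μ ≤ ∫ z, w z ∂μ := (clip_le hw0 hwm hwi hq0 hqm hv.le).1
  have h : v * (1 - rejCurve μ w q v) ≤ ∫ z, w z ∂μ := hM ▸ hMZ
  rw [sub_le_comm, le_div_iff₀ hv, mul_comm]
  exact h

/-- **WEIGHT-TAIL FLOOR UNDER EVERY AUTOCOVARIANCE.**  For every `t ≥ 1`, every `n` and every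
bounded measurable `g`:
`(1 − 1/t)^{n+1} ∫ 1[b > tZ] g² w dμ ≤ ∫ g (Kⁿ⁺¹ g) w dμ`. -/
theorem autocov_ge_weightTail (hw0 : ∀ t, 0 < w t) (hwm : Measurable w) (hwi : Integrable w μ)
    (hq0 : ∀ t, 0 < q t) (hqm : Measurable q) (hqi : Integrable q μ) (hq1 : ∫ z, q z ∂μ = 1)
    (n : ℕ) {g : X → ℝ} (hgm : Measurable g) {B : ℝ} (hgb : ∀ t, |g t| ≤ B) {t : ℝ}
    (ht : 1 ≤ t) :
    (1 - 1 / t) ^ (n + 1) * ∫ x, (if t * (∫ z, w z ∂μ) < w x / q x then g x ^ 2 * w x else 0) ∂μ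
      ≤ ∫ x, g x * ((imhOp μ w q)^[n + 1] g) x * w x ∂μ := by
  set Z : ℝ := ∫ z, w z ∂μ with hZdef
  have hZ : 0 < Z := integral_pos_of_pos hw0 hwi hq1
  have ht0 : 0 < t := lt_of_lt_of_le one_pos ht
  have hc0 : 0 ≤ 1 - 1 / t := by
    rw [sub_nonneg, div_le_one ht0]; exact ht
  have hc1 : 1 - 1 / t ≤ 1 := by
    have : 0 ≤ 1 / t := by positivity
    linarith
  have hb0 : ∀ x, 0 < w x / q x := fun x => div_pos (hw0 x) (hq0 x)
  have hbm : Measurable fun x => w x / q x := hwm.div hqm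
  obtain ⟨hr0, hr1, hrm⟩ := rejection_bounds (μ := μ) hw0 hwm hq0 hqm hqi hq1
  refine le_trans ?_ (autocov_ge_sticking hw0 hwm hwi hq0 hqm hqi hq1 n hgm hgb)
  rw [← integral_const_mul]
  -- integrability of both sides
  have hg2 : ∀ x, g x ^ 2 ≤ B ^ 2 := fun x => by
    rw [← sq_abs]; exact pow_le_pow_left₀ (abs_nonneg _) (hgb x) 2
  have hI0 : Integrable (fun x => (if t * Z < w x / q x then g x ^ 2 * w x else 0 : ℝ)) μ := by
    refine Integrable.mono' (hwi.const_mul (B ^ 2)) ((Measurable.ite (measurableSet_lt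
      measurable_const hbm) ((hgm.pow_const 2).mul hwm) measurable_const).aestronglyMeasurable)
      (Eventually.of_forall fun x => ?_)
    rw [Real.norm_eq_abs]
    show |(if t * Z < w x / q x then g x ^ 2 * w x else 0 : ℝ)| ≤ B ^ 2 * w x
    split_ifs
    · rw [abs_of_nonneg (mul_nonneg (sq_nonneg _) (hw0 x).le)]
      exact mul_le_mul_of_nonneg_right (hg2 x) (hw0 x).le
    · rw [abs_zero]; exact mul_nonneg (sq_nonneg _) (hw0 x).le
  have hIl : Integrable (fun x => (1 - 1 / t) ^ (n + 1)
      * (if t * Z < w x / q x then g x ^ 2 * w x else 0)) μ := hI0.const_mul _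
  have hIr : Integrable (fun x => g x ^ 2 * w x
      * (∫ z, (1 - imhAcceptQ w q x z) * q z ∂μ) ^ (n + 1)) μ :=
    integrable_sq_mul_weight_mul hw0 hwm hwi hgm (hrm.pow_const _) hgb
      (fun x => pow_nonneg (hr0 x) _) (fun x => pow_le_one₀ (hr0 x) (hr1 x))
  refine integral_mono hIl hIr fun x => ?_
  -- pointwise: on `{b > tZ}`, `(1 − 1/t) ≤ 1 − Z/b ≤ λ(b) = r(x)`
  show (1 - 1 / t) ^ (n + 1) * (if t * Z < w x / q x then g x ^ 2 * w x else 0)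
    ≤ g x ^ 2 * w x * (∫ z, (1 - imhAcceptQ w q x z) * q z ∂μ) ^ (n + 1)
  split_ifs with hx
  · have hrx : 1 - 1 / t ≤ ∫ z, (1 - imhAcceptQ w q x z) * q z ∂μ := by
      rw [rejection_eq_rejCurve hw0 hq0]
      refine le_trans ?_ (rejCurve_ge_one_sub_div hw0 hwm hwi hq0 hqm hqi hq1 (hb0 x))
      rw [← hZdef]
      have hbx : 0 < w x / q x := hb0 x
      have : Z / (w x / q x) ≤ 1 / t := by
        rw [div_le_div_iff₀ hbx ht0]
        linarith
      linarith
    rw [mul_comm]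
    exact mul_le_mul_of_nonneg_left (pow_le_pow_left₀ hc0 hrx _)
      (mul_nonneg (sq_nonneg _) (hw0 x).le)
  · rw [mul_zero]
    exact mul_nonneg (mul_nonneg (sq_nonneg _) (hw0 x).le) (pow_nonneg (hr0 x) _)

/-- **`ρ(n+1) ≥ (1 − 1/t)^{n+1} E_{g²w}[1[b > tZ]]/E[g²w]`**: the normalised weight-tail floor
under every autocorrelation of the exact flow sampler (`t ≥ 1`). -/
theorem autocorr_ge_weightTail (hw0 : ∀ t, 0 < w t) (hwm : Measurable w) (hwi : Integrable w μ)
    (hq0 : ∀ t, 0 < q t) (hqm : Measurable q) (hqi : Integrable q μ) (hq1 : ∫ z, q z ∂μ = 1)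
    (n : ℕ) {g : X → ℝ} (hgm : Measurable g) {B : ℝ} (hgb : ∀ t, |g t| ≤ B) {t : ℝ}
    (ht : 1 ≤ t) :
    (1 - 1 / t) ^ (n + 1) * (∫ x, (if t * (∫ z, w z ∂μ) < w x / q x then g x ^ 2 * w x else 0) ∂μ)
        / ∫ x, g x ^ 2 * w x ∂μ
      ≤ (∫ x, g x * ((imhOp μ w q)^[n + 1] g) x * w x ∂μ) / ∫ x, g x ^ 2 * w x ∂μ :=
  div_le_div_of_nonneg_right (autocov_ge_weightTail hw0 hwm hwi hq0 hqm hqi hq1 n hgm hgb ht)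
    (integral_nonneg fun x => mul_nonneg (sq_nonneg _) (hw0 x).le)

/-! ## The lattice: row 2's φ⁴ flow sampler -/

section Lattice

variable {n : ℕ}

/-- **WEIGHT-TAIL FLOOR FOR THE φ⁴ FLOW SAMPLER**: every `λ > 0`, real `J`, positive measurable
model density `q̃` with `∫ q̃ = 1`; `f` bounded measurable, `g = f − ⟨f⟩`, `Z = ∫ e^{−S}`,
`b = e^{−S}/q̃`.  For every `t ≥ 1` and every lag `k`:
`(1 − 1/t)^{k+1} ∫ 1[b > tZ] g² e^{−S} dφ ≤ ∫ g (K^{k+1} g) e^{−S} dφ`. -/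
theorem phi4Flow_autocov_ge_weightTail {lam : ℝ} (hlam : 0 < lam)
    (J : Fin (n + 1) → Fin (n + 1) → ℝ) {q : (Fin (n + 1) → ℝ) → ℝ} (hq0 : ∀ φ, 0 < q φ)
    (hqm : Measurable q) (hqi : Integrable q) (hq1 : ∫ φ, q φ = 1)
    {f : (Fin (n + 1) → ℝ) → ℝ} (hfm : Measurable f) {B : ℝ} (hfb : ∀ φ, |f φ| ≤ B) (k : ℕ)
    {t : ℝ} (ht : 1 ≤ t) :
    (1 - 1 / t) ^ (k + 1) * ∫ φ, (if t * (∫ ψ, gibbsWeight J lam ψ) < gibbsWeight J lam φ / q φ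
        then (f φ - gibbsExpect J lam f) ^ 2 * gibbsWeight J lam φ else 0)
      ≤ ∫ φ, (f φ - gibbsExpect J lam f)
        * ((imhOpPhi4 J lam q)^[k + 1] (fun ψ => f ψ - gibbsExpect J lam f)) φ
        * gibbsWeight J lam φ := by
  obtain ⟨hgm, hgb, -⟩ := centred_observable hlam J hfm hfb
  rw [imhOpPhi4_eq_imhOp]
  exact autocov_ge_weightTail (μ := volume) (fun ψ => gibbsWeight_pos J lam ψ)
    (continuous_gibbsWeight J lam).measurable (integrable_gibbsWeight hlam J) hq0 hqm hqi hq1 k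
    hgm hgb ht

end Lattice

end Summit.Ventures.LatticeQCDFlow.Exactness
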